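import Literature.NumberTheory.Automorphic.UnitaryGroupAdelicCharactersDetAllRanks
import HarnessLib

/-!
# Continuous characters of `U(J_N)(𝔸)` factor through the determinant — Mok's ANTIDIAGONAL form `J_N`, EVERY rank `N ≥ 2`

Topic `NumberTheory/Automorphic`; namespace `Literature.NumberTheory.Automorphic.UnitaryGroup.AdelicCharactersDetQuasiSplit`.
THEOREMS ONLY (no definition, no notation, no named fact, no instance, no `sorry`). The QUASI-SPLIT edition of ★
`UnitaryGroupAdelicCharactersDetAllRanks` (rank `N ≥ 3`, DIAGONAL `J = diag d`): the same place-by-place argument for the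
antidiagonal hermitian form `J_N = (StdForm.antidiagonal N).over L` of the tree's quasi-split unitary group `quasiSplit L⁺ L c N`
(Mok's `U_{E/F}(N)`), now for EVERY `N ≥ 2` — including `N = 2`, the rank-one quasi-split `U(1,1)` needed by the `H`-side
(`H = U(Φ₂) × U(Φ₁)`) of the trace formula of `U(3)` [Rogawski1990, §7.3 p. 98 «Let `G = U(3)`, `U(2)`, or `U(2) × U(1)`»].
The point: `J_N` carries the EXPLICIT, place-free isotropic vector `e₀` (`ᵗ(σ e₀) J_N e₀ = (J_N)₀₀ = 0` as soon as `N ≥ 2`), so at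
EVERY complex place and EVERY non-split finite place the rank-free engine ✔ `UnitaryIsotropic.apply_eq_one_of_det_eq_one(')`
([Dieudonne1971GroupesClassiques, Chap. II §5]: in an isotropic unitary group the kernel of `det` is generated by transvections,
which every homomorphism to an abelian group kills) applies directly — no definite case, no rank-`≥ 3` local isotropy input
(✔ `HermitianLocalIsotropy`); the split finite places (`U(J_N)(L⁺_v) ≅ GL_N(L_w)`, ✔ `GLHomDet`) and the adelic assembly
(✔ `UnitaryGroupPlaceTruncation`, ✔ `archPiEquivCM`) are those of the AllRanks file VERBATIM with `diag d ↦ J_N`.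

Setting: `L` a CM number field, `L⁺ = maximalRealSubfield L`, `c` = complex conjugation, `N ≥ 2`, `J_N = (StdForm.antidiagonal N).over L`
(`(c J_N)ᵀ = J_N`, `J_N² = 1`), `U(J_N)(𝔸_{L⁺}) = UnitaryGroup.adelic L⁺ L c N J_N ≤ GL_N(𝔸_L)` (= `(quasiSplit L⁺ L c N).Adelic`).

* `antidiagonal_over_isotropic` — `e₀` is isotropic for `J_N` over any commutative ring with any ring endomorphism `σ`, `N ≥ 2`;
* `archLocal_apply_eq_one`, `localPi_apply_eq_one`, `finAdelic_apply_eq_one`, `arch_apply_eq_one` — the local and semi-local steps;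
* **`apply_eq_one_of_det_eq_one`** — every CONTINUOUS `χ : U(J_N)(𝔸_{L⁺}) →* ℂˣ` kills the elements of determinant `1`;
* `apply_eq_one_of_adelicDet_eq_one`, **`eq_comp_sec_comp_adelicDet`** — `χ = (χ ∘ sec) ∘ det` for any section `sec` of `adelicDet`
  ([GelbartRogawski1991, §3.1 Remark p. 457 L9–13] «a character of `G` through `det`», here for the quasi-split `G = U(N)`, `N ≥ 2`).

Consumer: ✔ `AdelicUnitaryGroupUnimodular.modularCharacter_adelic_eq_one_of_characters` (any form `J`, `N ≠ 0`) ⇒ the quasi-split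
`U(J_N)(𝔸_{L⁺})` is unimodular for every `N ≥ 2` (`AdelicUnitaryGroupUnimodularQuasiSplit`). Cell `hodgecm-mathlib`, H-side road
brick H-B2 of the T1 engine (crux H413). HC_CM is proved only modulo the printed citations until rung 0 closes — nothing here bears on
a summit statement.

## References

* S. Gelbart, J. Rogawski, Invent. Math. 105 (1991), §3.1 Remark p. 457 [GelbartRogawski1991].
* J. Dieudonné, *La géométrie des groupes classiques* (1971), Chap. II §5 [Dieudonne1971GroupesClassiques].
* J. D. Rogawski, *Automorphic Representations of Unitary Groups in Three Variables* (1990), §7.3 (p. 98) [Rogawski1990].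
* C. P. Mok, Mem. AMS 235 (2015), §1 Notation p. 5 (the form `J_N`) [Mok2014].
-/

set_option autoImplicit false

noncomputable section

open NumberField IsDedekindDomain Matrix
open scoped MatrixGroups

namespace Literature.NumberTheory.Automorphic

namespace UnitaryGroup.AdelicCharactersDetQuasiSplit

open Literature.LinearAlgebra.Matrix NumberField.InfinitePlace
open Literature.NumberTheory.GelbartRogawski1991.UnitaryDualPair (imagUnit complexConj_imagUnit imagUnit_ne_zero)

/-! ## §0 The explicit isotropic vector `e₀` of Mok's form -/

/-- **`e₀` is isotropic for `J_N = antidiag(1, …, 1)` as soon as `N ≥ 2`**: `ᵗ(σ e₀) J_N e₀ = (J_N)₀₀ = 0` (the `(0,0)` entry of the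
antidiagonal form vanishes because `0 ≠ N − 1`), over any commutative ring `K` and for any ring endomorphism `σ`.
[cite: Mok2014, §1 Notation p. 5] -/
theorem antidiagonal_over_isotropic {K : Type*} [CommRing K] [Nontrivial K] (σ : K →+* K) {N : ℕ} (hN : 2 ≤ N) :
    ∃ x : Fin N → K, x ≠ 0 ∧ dotProduct (fun i => σ (x i)) (((StdForm.antidiagonal N).over K).mulVec x) = 0 := by
  classical
  set i₀ : Fin N := ⟨0, by omega⟩ with hi₀
  refine ⟨Pi.single i₀ (1 : K), fun h => one_ne_zero (α := K) (by simpa using congrFun h i₀), ?_⟩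
  have hσ : (fun i => σ ((Pi.single i₀ (1 : K) : Fin N → K) i)) = Pi.single i₀ 1 := by
    funext i
    by_cases h : i = i₀
    · subst h; simp
    · simp [h]
  rw [hσ, single_dotProduct, one_mul, Matrix.mulVec_single_one, Matrix.col_apply, StdForm.over, Matrix.map_apply,
    StdForm.antidiagonal_J_apply, if_neg, map_zero]
  intro h
  have h' := congrArg Fin.val h
  rw [Fin.val_rev] at h'
  simp only [hi₀] at h'
  omega

/-- `J_N` over `K` is hermitian for any ring endomorphism `σ` (its entries are `0, 1`). [cite: Mok2014, §1 Notation p. 5] -/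
theorem antidiagonal_over_map_transpose {K K' : Type*} [CommRing K] [CommRing K'] (σ : K →+* K') (N : ℕ) :
    (((StdForm.antidiagonal N).over K).map σ).transpose = (StdForm.antidiagonal N).over K' := by
  rw [StdForm.over_map, StdForm.transpose_over]

/-- `det J_N ≠ 0` over a nontrivial commutative ring (`J_N² = 1`). [cite: Mok2014, §1 Notation p. 5] -/
theorem antidiagonal_over_det_ne_zero (K : Type*) [CommRing K] [Nontrivial K] (N : ℕ) :
    ((StdForm.antidiagonal N).over K).det ≠ 0 :=
  ((Matrix.isUnit_iff_isUnit_det _).1 ((StdForm.antidiagonal N).isUnit_over K)).ne_zero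

variable (L : Type) [Field L] [NumberField L] [IsCMField L] {A : Type*} [CommGroup A] {N : ℕ} (hN : 2 ≤ N)

/-! ## §1 The complex places: `U(σ_w J_N)(ℂ) = U(J_N)(ℂ)` is isotropic -/

omit [NumberField L] [IsCMField L] in
include hN in
/-- **At a complex place `w`, every homomorphism `U(σ_w J_N)(ℂ) →* A` kills the determinant-one elements** (`σ_w J_N = J_N`
over `ℂ`, isotropic vector `e₀`, engine ✔ `UnitaryIsotropic.apply_eq_one_of_det_eq_one'`). [cite: Dieudonne1971GroupesClassiques, Chap. II §5] -/
theorem archLocal_apply_eq_one (w : {w : InfinitePlace L // IsComplex w})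
    (θ : ↥(UnitaryGroup.archLocal L N ((StdForm.antidiagonal N).over L) w) →* A)
    (x : ↥(UnitaryGroup.archLocal L N ((StdForm.antidiagonal N).over L) w)) (hx : x.1.1.det = 1) : θ x = 1 := by
  classical
  have hM : ((StdForm.antidiagonal N).over L).map w.1.embedding = (StdForm.antidiagonal N).over ℂ := StdForm.over_map _ _
  exact UnitaryIsotropic.apply_eq_one_of_det_eq_one' (σ := starRingEnd ℂ) (θ₀ := Complex.I)
    Complex.conj_conj Complex.conj_I Complex.I_ne_zero two_ne_zero _ ((StdForm.antidiagonal N).over ℂ) hM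
    (antidiagonal_over_map_transpose (starRingEnd ℂ) N) (antidiagonal_over_det_ne_zero ℂ N)
    (antidiagonal_over_isotropic (starRingEnd ℂ) hN) θ x hx

/-! ## §2 The finite places -/

include hN in
/-- **At a finite place `v` of `L⁺`, every homomorphism `U(J_N)(L⁺_v) →* A` kills the elements all of whose components have
determinant one** (non-split `v`: `L ⊗ L⁺_v` is a field and `J_N` is isotropic there by `e₀`, so ✔ `UnitaryIsotropic.apply_eq_one_of_det_eq_one'`
applies; split `v`: `U(J_N)(L⁺_v) ≅ GL_N(L_w)` and ✔ `GLHomDet`). [cite: Dieudonne1971GroupesClassiques, Chap. II §5] -/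
theorem localPi_apply_eq_one (v : HeightOneSpectrum (𝓞 ↥(maximalRealSubfield L)))
    (θ : ↥(UnitaryGroup.localPi L (IsCMField.complexConj L) N ((StdForm.antidiagonal N).over L) v) →* A)
    (u : ↥(UnitaryGroup.localPi L (IsCMField.complexConj L) N ((StdForm.antidiagonal N).over L) v))
    (hu : ∀ w : UnitaryGroup.PlacesOver L v, (((u : UnitaryGroup.LocalGLPi L N v) w : GL (Fin N) (w.1.adicCompletion L)) :
      Matrix (Fin N) (Fin N) (w.1.adicCompletion L)).det = 1) : θ u = 1 := by
  classical
  have hcδ : IsCMField.complexConj L (imagUnit L) = -imagUnit L := complexConj_imagUnit L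
  have hδ : imagUnit L ≠ 0 := imagUnit_ne_zero L
  have hc : IsCMField.complexConj L ≠ 1 := IsCMField.complexConj_ne_one L
  obtain ⟨w⟩ : Nonempty (UnitaryGroup.PlacesOver L v) := inferInstance
  by_cases hw : IsCMField.complexConj L • w.1 = w.1
  · -- non-split: the field `K = L ⊗ L⁺_v`
    letI : Field (UnitaryGroup.LocalRing L v) :=
      (UnitaryGroup.LocalRing.isField_of_smul_eq (IsCMField.complexConj L) hc w hw).toField
    have hσ : ∀ x, UnitaryGroup.conjLocal L (IsCMField.complexConj L) v
        (UnitaryGroup.conjLocal L (IsCMField.complexConj L) v x) = x :=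
      UnitaryGroup.conjLocal_conjLocal (IsCMField.complexConj L) v hcδ hδ
    have hθ : UnitaryGroup.conjLocal L (IsCMField.complexConj L) v
        (algebraMap L (UnitaryGroup.LocalRing L v) (imagUnit L)) = -algebraMap L (UnitaryGroup.LocalRing L v) (imagUnit L) := by
      rw [UnitaryGroup.conjLocal_algebraMap, hcδ, map_neg]
    have hθ0 : algebraMap L (UnitaryGroup.LocalRing L v) (imagUnit L) ≠ 0 := (_root_.map_ne_zero _).2 hδ
    have h2 : (2 : UnitaryGroup.LocalRing L v) ≠ 0 := by
      rw [← map_ofNat (algebraMap L (UnitaryGroup.LocalRing L v)) 2]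
      exact (_root_.map_ne_zero _).2 two_ne_zero
    set ψ := UnitaryGroup.localPiEquiv L (IsCMField.complexConj L) N ((StdForm.antidiagonal N).over L) v with hψ
    set p := ψ u with hp
    have hup : u = ψ.symm p := (ψ.symm_apply_apply u).symm
    -- the matrix of `p` has determinant one (componentwise)
    have hpdet : ((p : GL (Fin N) (UnitaryGroup.LocalRing L v)) : Matrix (Fin N) (Fin N) (UnitaryGroup.LocalRing L v)).det = 1 := by
      funext w'
      have hmat : ((((ψ.symm p : UnitaryGroup.localPi L (IsCMField.complexConj L) N ((StdForm.antidiagonal N).over L) v) :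
          UnitaryGroup.LocalGLPi L N v) w' : GL (Fin N) (w'.1.adicCompletion L)) :
            Matrix (Fin N) (Fin N) (w'.1.adicCompletion L)) =
          ((p : GL (Fin N) (UnitaryGroup.LocalRing L v)) : Matrix (Fin N) (Fin N) (UnitaryGroup.LocalRing L v)).map
            (Pi.evalRingHom (fun w'' : UnitaryGroup.PlacesOver L v => w''.1.adicCompletion L) w') :=
        GLn.coe_piEquiv_apply _ _ _ _
      have h1 := hu w'
      rw [hup, hmat, ← RingHom.mapMatrix_apply, ← RingHom.map_det] at h1
      exact h1
    -- the local form is `J_N` over `K`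
    have hM : (UnitaryGroup.adelicForm L N ((StdForm.antidiagonal N).over L)).map (UnitaryGroup.adeleToLocal L v) =
        (StdForm.antidiagonal N).over (UnitaryGroup.LocalRing L v) := by
      rw [UnitaryGroup.adelicForm, Matrix.map_map]
      exact StdForm.over_map _ ((UnitaryGroup.adeleToLocal L v).comp (algebraMap L (AdeleRing (𝓞 L) L)))
    have key := UnitaryIsotropic.apply_eq_one_of_det_eq_one'
      (σ := UnitaryGroup.conjLocal L (IsCMField.complexConj L) v) hσ hθ hθ0 h2 _
      ((StdForm.antidiagonal N).over (UnitaryGroup.LocalRing L v)) hM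
      (antidiagonal_over_map_transpose (UnitaryGroup.conjLocal L (IsCMField.complexConj L) v) N)
      (antidiagonal_over_det_ne_zero (UnitaryGroup.LocalRing L v) N)
      (antidiagonal_over_isotropic (UnitaryGroup.conjLocal L (IsCMField.complexConj L) v) hN)
      (θ.comp ψ.symm.toMonoidHom) p hpdet
    rw [hup]
    exact key
  · -- split: `U(J_N)(L⁺_v) ≅ GL_N(L_w)`
    have hJh : (((StdForm.antidiagonal N).over L).map (IsCMField.complexConj L : L →+* L))ᵀ = (StdForm.antidiagonal N).over L :=
      antidiagonal_over_map_transpose _ N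
    have hJu : IsUnit ((StdForm.antidiagonal N).over L) := (StdForm.antidiagonal N).isUnit_over L
    have hJw := UnitaryGroup.isUnit_placeForm ((StdForm.antidiagonal N).over L) hJu w.1
    set ψ := UnitaryGroup.localPiSplitEquiv (IsCMField.complexConj L) ((StdForm.antidiagonal N).over L) hc hJh w hw hJw with hψ
    have h2 : (2 : w.1.adicCompletion L) ≠ 0 := by
      rw [← map_ofNat (algebraMap L (w.1.adicCompletion L)) 2]
      exact (_root_.map_ne_zero _).2 two_ne_zero
    have key : θ (ψ.symm (ψ u)) = 1 :=
      GLHomDet.apply_eq_one_of_val_det_eq_one_of_two_ne_zero h2 (θ.comp ψ.symm.toMonoidHom) (g := ψ u) (hu w)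
    rwa [ψ.symm_apply_apply] at key

/-! ## §3 The finite-adelic assembly: density of the finitely supported determinant-one elements -/

include hN in
/-- **A continuous homomorphism `U(J_N)(𝔸_{L⁺,f}) →* ℂˣ` kills every element all of whose local components have
determinant one** (truncations are finite products of place inclusions, §2, and converge).
[cite: GelbartRogawski1991, §3.1 Remark p. 457] -/
theorem finAdelic_apply_eq_one
    (θ : ↥(UnitaryGroup.finAdelic (↥(maximalRealSubfield L)) L (IsCMField.complexConj L) N ((StdForm.antidiagonal N).over L)) →* ℂˣ)
    (hθ : Continuous θ)
    (b : ↥(UnitaryGroup.finAdelic (↥(maximalRealSubfield L)) L (IsCMField.complexConj L) N ((StdForm.antidiagonal N).over L)))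
    (hb : ∀ (v : HeightOneSpectrum (𝓞 ↥(maximalRealSubfield L))) (w : UnitaryGroup.PlacesOver L v),
      (((UnitaryGroup.evalPlace (↥(maximalRealSubfield L)) L (IsCMField.complexConj L) N ((StdForm.antidiagonal N).over L) v b :
        UnitaryGroup.localPi L (IsCMField.complexConj L) N ((StdForm.antidiagonal N).over L) v) : UnitaryGroup.LocalGLPi L N v) w :
          Matrix (Fin N) (Fin N) (w.1.adicCompletion L)).det = 1) : θ b = 1 := by
  classical
  let P : Set ↥(UnitaryGroup.finAdelic (↥(maximalRealSubfield L)) L (IsCMField.complexConj L) N ((StdForm.antidiagonal N).over L)) :=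
    {g | ∀ v (w : UnitaryGroup.PlacesOver L v),
      ((((UnitaryGroup.evalPlace (↥(maximalRealSubfield L)) L (IsCMField.complexConj L) N ((StdForm.antidiagonal N).over L) v g :
        UnitaryGroup.localPi L (IsCMField.complexConj L) N ((StdForm.antidiagonal N).over L) v) : UnitaryGroup.LocalGLPi L N v) w :
          GL (Fin N) (w.1.adicCompletion L)) : Matrix (Fin N) (Fin N) (w.1.adicCompletion L)).det = 1}
  have hP : ∀ g ∈ P, ∀ S, UnitaryGroup.truncPlaces (↥(maximalRealSubfield L)) L (IsCMField.complexConj L) N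
      ((StdForm.antidiagonal N).over L) S g ∈ P := by
    intro g hg S v w
    exact UnitaryGroup.truncPlaces_mem_setOf_forall (↥(maximalRealSubfield L)) L (IsCMField.complexConj L) N
      ((StdForm.antidiagonal N).over L)
      (p := fun v u => ∀ w : UnitaryGroup.PlacesOver L v,
        (((u : UnitaryGroup.LocalGLPi L N v) w : GL (Fin N) (w.1.adicCompletion L)) :
          Matrix (Fin N) (Fin N) (w.1.adicCompletion L)).det = 1)
      (fun v w => by simp) hg S v w
  -- on the finitely supported elements of `P`, by induction on the support
  have hind : ∀ g ∈ P, ∀ S : Finset (HeightOneSpectrum (𝓞 ↥(maximalRealSubfield L))),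
      θ (UnitaryGroup.truncPlaces (↥(maximalRealSubfield L)) L (IsCMField.complexConj L) N ((StdForm.antidiagonal N).over L) S g) = 1 := by
    intro g hg S
    induction S using Finset.induction_on with
    | empty => rw [UnitaryGroup.truncPlaces_empty, map_one]
    | @insert v S hv ih =>
      rw [UnitaryGroup.truncPlaces_insert _ _ _ _ _ hv, map_mul, ih, mul_one]
      exact localPi_apply_eq_one L hN v
        (θ.comp (UnitaryGroup.inclPlace (↥(maximalRealSubfield L)) L (IsCMField.complexConj L) N ((StdForm.antidiagonal N).over L) v))
        _ (hg v)
  have hEq := UnitaryGroup.eqOn_of_eqOn_inter_finSupp (↥(maximalRealSubfield L)) L (IsCMField.complexConj L) N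
    ((StdForm.antidiagonal N).over L) hP (f := fun g => θ g) (f' := fun _ => (1 : ℂˣ)) hθ continuous_const ?_
  · exact hEq hb
  · rintro g ⟨hg, hgs⟩
    obtain ⟨S, hS⟩ := (UnitaryGroup.mem_finSupp_iff_exists_truncPlaces_eq (↥(maximalRealSubfield L)) L
      (IsCMField.complexConj L) N ((StdForm.antidiagonal N).over L) g).1 hgs
    show θ g = 1
    rw [← hS]
    exact hind g hg S

/-! ## §4 The archimedean assembly -/

include hN in
/-- **A homomorphism `U(J_N)(L⁺ ⊗ ℝ) →* A` kills every element all of whose complex components have determinant one**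
(`U(J_N)(L⁺ ⊗ ℝ) ≅ ∏_w U(σ_w J_N)(ℂ)`, §1, `Subgroup.pi_mem_of_mulSingle_mem`). [cite: GelbartRogawski1991, §3.1 Remark p. 457] -/
theorem arch_apply_eq_one
    (θ : ↥(UnitaryGroup.arch (↥(maximalRealSubfield L)) L (IsCMField.complexConj L) N ((StdForm.antidiagonal N).over L)) →* A)
    (a : ↥(UnitaryGroup.arch (↥(maximalRealSubfield L)) L (IsCMField.complexConj L) N ((StdForm.antidiagonal N).over L)))
    (ha : ∀ w : {w : InfinitePlace L // IsComplex w},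
      (((UnitaryGroup.archPiEquivCM N L ((StdForm.antidiagonal N).over L) a w :
        UnitaryGroup.archLocal L N ((StdForm.antidiagonal N).over L) w) : GL (Fin N) ℂ) : Matrix (Fin N) (Fin N) ℂ).det = 1) :
    θ a = 1 := by
  classical
  set ψ := UnitaryGroup.archPiEquivCM N L ((StdForm.antidiagonal N).over L) with hψ
  set θ' : (∀ w : {w : InfinitePlace L // IsComplex w}, ↥(UnitaryGroup.archLocal L N ((StdForm.antidiagonal N).over L) w)) →* A :=
    θ.comp ψ.symm.toMulEquiv.toMonoidHom with hθ'
  have hmem : ψ a ∈ θ'.ker := by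
    refine Subgroup.pi_mem_of_mulSingle_mem (ψ a) fun w => ?_
    rw [MonoidHom.mem_ker]
    have := archLocal_apply_eq_one L hN w
      (θ'.comp (MonoidHom.mulSingle (fun w' : {w : InfinitePlace L // IsComplex w} =>
        ↥(UnitaryGroup.archLocal L N ((StdForm.antidiagonal N).over L) w')) w)) (ψ a w) (ha w)
    simpa using this
  rw [MonoidHom.mem_ker] at hmem
  have hθa : θ' (ψ a) = θ a := by
    show θ (ψ.symm (ψ a)) = θ a
    rw [ψ.symm_apply_apply]
  rw [← hθa, hmem]

/-! ## §5 The adelic assembly: `SU(J_N)(𝔸) ≤ ker χ` and the factorisation through `det` -/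

include hN in
/-- **Every continuous homomorphism `χ : U(J_N)(𝔸_{L⁺}) →* ℂˣ` kills the elements of determinant one** (Mok's antidiagonal
`J_N`, every rank `N ≥ 2`, CM field `L`; `g = g_∞ · g_f`, §§3–4). [cite: GelbartRogawski1991, §3.1 Remark p. 457] -/
theorem apply_eq_one_of_det_eq_one
    (χ : ↥(UnitaryGroup.adelic (↥(maximalRealSubfield L)) L (IsCMField.complexConj L) N ((StdForm.antidiagonal N).over L)) →* ℂˣ)
    (hχ : Continuous χ)
    (g : ↥(UnitaryGroup.adelic (↥(maximalRealSubfield L)) L (IsCMField.complexConj L) N ((StdForm.antidiagonal N).over L)))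
    (hg : ((g : GL (Fin N) (AdeleRing (𝓞 L) L)) : Matrix (Fin N) (Fin N) (AdeleRing (𝓞 L) L)).det = 1) : χ g = 1 := by
  classical
  have hdec := UnitaryGroup.archToAdelic_mul_finAdelicToAdelic (↥(maximalRealSubfield L)) L (IsCMField.complexConj L) N
    ((StdForm.antidiagonal N).over L) g
  -- archimedean components have determinant one
  have ha : ∀ w : {w : InfinitePlace L // IsComplex w},
      (((UnitaryGroup.archPiEquivCM N L ((StdForm.antidiagonal N).over L)
        (UnitaryGroup.archPart (↥(maximalRealSubfield L)) L (IsCMField.complexConj L) N ((StdForm.antidiagonal N).over L) g) w :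
          UnitaryGroup.archLocal L N ((StdForm.antidiagonal N).over L) w) : GL (Fin N) ℂ) : Matrix (Fin N) (Fin N) ℂ).det = 1 := by
    intro w
    let Φ : AdeleRing (𝓞 L) L →+* ℂ :=
      (UnitaryGroup.evalC L w).comp ((InfiniteAdeleRing.ringEquiv_mixedSpace L).toRingHom.comp (RingHom.fst _ _))
    have hmat : (((UnitaryGroup.archPiEquivCM N L ((StdForm.antidiagonal N).over L)
        (UnitaryGroup.archPart (↥(maximalRealSubfield L)) L (IsCMField.complexConj L) N ((StdForm.antidiagonal N).over L) g) w :
          UnitaryGroup.archLocal L N ((StdForm.antidiagonal N).over L) w) : GL (Fin N) ℂ) : Matrix (Fin N) (Fin N) ℂ) =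
        ((g : GL (Fin N) (AdeleRing (𝓞 L) L)) : Matrix (Fin N) (Fin N) (AdeleRing (𝓞 L) L)).map Φ :=
      Matrix.ext fun i j => rfl
    rw [hmat, ← RingHom.mapMatrix_apply, ← RingHom.map_det, hg, map_one]
  -- finite components have determinant one
  have hb : ∀ (v : HeightOneSpectrum (𝓞 ↥(maximalRealSubfield L))) (w : UnitaryGroup.PlacesOver L v),
      (((UnitaryGroup.evalPlace (↥(maximalRealSubfield L)) L (IsCMField.complexConj L) N ((StdForm.antidiagonal N).over L) v
        (UnitaryGroup.finPart (↥(maximalRealSubfield L)) L (IsCMField.complexConj L) N ((StdForm.antidiagonal N).over L) g) :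
          UnitaryGroup.localPi L (IsCMField.complexConj L) N ((StdForm.antidiagonal N).over L) v) : UnitaryGroup.LocalGLPi L N v) w :
            Matrix (Fin N) (Fin N) (w.1.adicCompletion L)).det = 1 := by
    intro v w
    let Ψ : AdeleRing (𝓞 L) L →+* w.1.adicCompletion L :=
      (AdelicGroupData.finiteAdeleEval L w.1).comp (RingHom.snd _ _)
    have hmat : ((((UnitaryGroup.evalPlace (↥(maximalRealSubfield L)) L (IsCMField.complexConj L) N ((StdForm.antidiagonal N).over L) v
        (UnitaryGroup.finPart (↥(maximalRealSubfield L)) L (IsCMField.complexConj L) N ((StdForm.antidiagonal N).over L) g) :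
          UnitaryGroup.localPi L (IsCMField.complexConj L) N ((StdForm.antidiagonal N).over L) v) : UnitaryGroup.LocalGLPi L N v) w :
            GL (Fin N) (w.1.adicCompletion L)) : Matrix (Fin N) (Fin N) (w.1.adicCompletion L)) =
        ((g : GL (Fin N) (AdeleRing (𝓞 L) L)) : Matrix (Fin N) (Fin N) (AdeleRing (𝓞 L) L)).map Ψ :=
      Matrix.ext fun i j => rfl
    rw [hmat, ← RingHom.mapMatrix_apply, ← RingHom.map_det, hg, map_one]
  have h1 := arch_apply_eq_one L hN
    (χ.comp (UnitaryGroup.archToAdelic (↥(maximalRealSubfield L)) L (IsCMField.complexConj L) N ((StdForm.antidiagonal N).over L)))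
    _ ha
  have h2 := finAdelic_apply_eq_one L hN
    (χ.comp (UnitaryGroup.finAdelicToAdelic (↥(maximalRealSubfield L)) L (IsCMField.complexConj L) N ((StdForm.antidiagonal N).over L)))
    (hχ.comp (UnitaryGroup.continuous_finAdelicToAdelic (↥(maximalRealSubfield L)) L (IsCMField.complexConj L) N
      ((StdForm.antidiagonal N).over L))) _ hb
  rw [MonoidHom.comp_apply] at h1 h2
  exact (congrArg χ hdec.symm).trans ((map_mul χ _ _).trans ((congrArg₂ (· * ·) h1 h2).trans (one_mul 1)))

include hN in
/-- The determinant-one condition phrased with `UnitaryGroup.adelicDet`. [cite: GelbartRogawski1991, §3.1 Remark p. 457] -/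
theorem apply_eq_one_of_adelicDet_eq_one (hJ : ((StdForm.antidiagonal N).over L).det ≠ 0)
    (χ : ↥(UnitaryGroup.adelic (↥(maximalRealSubfield L)) L (IsCMField.complexConj L) N ((StdForm.antidiagonal N).over L)) →* ℂˣ)
    (hχ : Continuous χ)
    (g : ↥(UnitaryGroup.adelic (↥(maximalRealSubfield L)) L (IsCMField.complexConj L) N ((StdForm.antidiagonal N).over L)))
    (hg : UnitaryGroup.adelicDet (↥(maximalRealSubfield L)) L (IsCMField.complexConj L) N ((StdForm.antidiagonal N).over L) hJ g = 1) :
    χ g = 1 := by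
  refine apply_eq_one_of_det_eq_one L hN χ hχ g ?_
  have := congrArg (fun u : UnitaryGroup.adelicOne (↥(maximalRealSubfield L)) L (IsCMField.complexConj L) =>
    (((u : (AdeleRing (𝓞 L) L)ˣ) : AdeleRing (𝓞 L) L))) hg
  simpa [UnitaryGroup.coe_coe_adelicDet] using this

include hN in
/-- **The factorisation through the determinant**: for ANY section `sec` of `adelicDet`, every continuous
`χ : U(J_N)(𝔸_{L⁺}) →* ℂˣ` equals `(χ ∘ sec) ∘ det` — [GelbartRogawski1991, §3.1 Remark p. 457 L9–13] for the quasi-split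
`G = U(N)`, every `N ≥ 2`. [cite: GelbartRogawski1991, §3.1 Remark p. 457] -/
theorem eq_comp_sec_comp_adelicDet (hJ : ((StdForm.antidiagonal N).over L).det ≠ 0)
    (sec : ↥(UnitaryGroup.adelicOne (↥(maximalRealSubfield L)) L (IsCMField.complexConj L)) →*
      ↥(UnitaryGroup.adelic (↥(maximalRealSubfield L)) L (IsCMField.complexConj L) N ((StdForm.antidiagonal N).over L)))
    (hsec : ∀ u, UnitaryGroup.adelicDet (↥(maximalRealSubfield L)) L (IsCMField.complexConj L) N ((StdForm.antidiagonal N).over L) hJ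
      (sec u) = u)
    (χ : ↥(UnitaryGroup.adelic (↥(maximalRealSubfield L)) L (IsCMField.complexConj L) N ((StdForm.antidiagonal N).over L)) →* ℂˣ)
    (hχ : Continuous χ) :
    χ = (χ.comp sec).comp
      (UnitaryGroup.adelicDet (↥(maximalRealSubfield L)) L (IsCMField.complexConj L) N ((StdForm.antidiagonal N).over L) hJ) := by
  refine MonoidHom.ext fun g => ?_
  set D := UnitaryGroup.adelicDet (↥(maximalRealSubfield L)) L (IsCMField.complexConj L) N ((StdForm.antidiagonal N).over L) hJ with hD
  have h1 : D (g * (sec (D g))⁻¹) = 1 := by rw [map_mul, map_inv, hsec, mul_inv_cancel]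
  have h2 := apply_eq_one_of_adelicDet_eq_one L hN hJ χ hχ _ h1
  rw [map_mul, map_inv, mul_inv_eq_one] at h2
  rw [MonoidHom.comp_apply, MonoidHom.comp_apply]
  exact h2

end UnitaryGroup.AdelicCharactersDetQuasiSplit

end Literature.NumberTheory.Automorphic

end
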